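import Summits.ResolutionOfSingularities.ResolutionOfSingularities.Theorems.WeightedInvariantIota3JSigmaDominanceSecondMember
import HarnessLib

/-!
# (o70-b) PART 2f — THE θ-BOUND ON THE FIRST MEMBER (generalised (E1): `g₂' ∈ F(b₀)` ⇒ `g₁' ∈ F(k+1)` for `k·r₂ < b₀·r₁`)
# (door `HypersurfaceCentreConstruction`, stmt-ResolutionOfSingularities-19897; clause h8 ⟸ (σ-pres)₃ ⟸ (o70-a) + (o70-b) + (o70-x);
# SPEC (Δ12) rev 4 `L/res-L1-w43-plan-1/JSigmaCanon_sketch.lean` d065476ee61016ce (l.224 / l.249) of res-L1-w43-plan-1; hand res-D-brk-1)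

Topic: `Summits/ResolutionOfSingularities/ResolutionOfSingularities/Theorems`. Helper for the door item
`HypersurfaceCentreConstruction` (stmt-ResolutionOfSingularities-19897, route `WeightedInvariant`), line `local-engine`
(L W4.3), def-free.  Roadmap item (R1) of `D/res-D-brk-1/O70B-JCAN-PLAN.md` §5.  PART 2c (p567666) proved (E1): `g₂' ∈ F(r₂) ⇒ g₁' ∈ F(r₁)`.
When the second member only reaches level `b₀ ≤ r₂` of the other flag's filtration (by PART 2d, p568580, a NON-dominant `g₂'` has
`b₀ = qm < r₂`), the same valuation argument bounds the first member proportionally: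

* `succ_le_weight_of_ne_top_piece'`, `rest₂_le_flagContactFiltration'` — bookkeeping with `g₂' ∈ F(b₀)`, `a·r₂ < b₀·r₁`;
* `mem_succ_of_mem_weight₂_le` — **(E1″)**: `𝔪 = (x, g₂, g₁)` (regular, `dim 3`), `0 < q ≤ r₂ < r₁`, `f ∉ 𝔪^{ν+1}` in level `r₁ν` of
  both filtrations, `g₂' ∈ F(b₀)` (`1 ≤ b₀ ≤ r₂`), `k + 1 ≤ r₁`, `k·r₂ < b₀·r₁` ⇒ `g₁' ∈ F(k+1)`.  So `W(g₁')/r₁ ≥ W(g₂')/r₂` up to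
  rounding: the first member is never "more non-dominant" than the second ((E1) = the case `b₀ = r₂`, `k + 1 = r₁`).

[OURS · L1 W4.3 · (o70-b) PART 2f]  Replaces the role of NO printed item; NOT a statement of the manuscript
[claim: Hironaka2017, status: under-review]. AI work, weaker than expert review.  No named facts.
-/

noncomputable section

set_option linter.dupNamespace false -- mandated namespace `Summit.<Summit>.<Problem>` of this single-conjunct summit

open IsLocalRing Literature.AlgebraicGeometry.Resolution
open Summit.ResolutionOfSingularities.ResolutionOfSingularities.Theorems

namespace Summit.ResolutionOfSingularities.ResolutionOfSingularities.Cruxes.HypersurfaceCentreConstruction.LocalEngine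

namespace Iota3

universe u

/-! ## §0 Bookkeeping with a partial second weight `b₀` -/

/-- For `(α, β) ≠ (ν, 0)`, `1 ≤ a`, `1 ≤ b₀ ≤ r₂`, `a·r₂ < b₀·r₁` and `r₁ν − r₁α − r₂β ≤ q·e`:
`νa + 1 ≤ αa + βb₀ + q·e`. [folklore] -/
theorem succ_le_weight_of_ne_top_piece' {q r₁ r₂ ν α β e a b₀ : ℕ} (ha : 1 ≤ a) (hb₀ : 1 ≤ b₀) (hb₀r : b₀ ≤ r₂)
    (hab : a * r₂ < b₀ * r₁) (hne : ¬ (α = ν ∧ β = 0)) (he : r₁ * ν - r₁ * α - r₂ * β ≤ q * e) :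
    ν * a + 1 ≤ α * a + β * b₀ + q * e := by
  rcases Nat.lt_or_ge ν α with h | h
  · have h1 : (ν + 1) * a ≤ α * a := Nat.mul_le_mul_right a h
    have h2 : (ν + 1) * a = ν * a + a := by ring
    omega
  rcases Nat.lt_or_ge α ν with h' | h'
  · obtain ⟨d, rfl⟩ : ∃ d, ν = α + (d + 1) := ⟨ν - α - 1, by omega⟩
    rw [Nat.mul_add, Nat.add_sub_cancel_left] at he
    have hνa : (α + (d + 1)) * a = α * a + a * (d + 1) := by ring
    have hab' : a * r₂ * (d + 1) < b₀ * r₁ * (d + 1) := Nat.mul_lt_mul_of_pos_right hab (Nat.succ_pos d)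
    have hab'' : r₂ * (a * (d + 1)) < b₀ * (r₁ * (d + 1)) := by
      calc r₂ * (a * (d + 1)) = a * r₂ * (d + 1) := by ring
        _ < b₀ * r₁ * (d + 1) := hab'
        _ = b₀ * (r₁ * (d + 1)) := by ring
    rcases Nat.lt_or_ge (r₁ * (d + 1)) (r₂ * β) with hgt | hle
    · -- outside the triangle: `β b₀ > a (d+1)`
      have h1 : b₀ * (r₁ * (d + 1)) ≤ b₀ * (r₂ * β) := Nat.mul_le_mul_left _ hgt.le
      have key : r₂ * (a * (d + 1)) < r₂ * (β * b₀) := by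
        calc r₂ * (a * (d + 1)) < b₀ * (r₁ * (d + 1)) := hab''
          _ ≤ b₀ * (r₂ * β) := h1
          _ = r₂ * (β * b₀) := by ring
      have h3 := Nat.lt_of_mul_lt_mul_left key
      omega
    · -- inside the triangle: `(r₁ − a)(d+1) > β (r₂ − b₀)`
      have har : a < r₁ := by
        by_contra hc
        have := Nat.mul_le_mul hb₀r (not_lt.mp hc)
        rw [mul_comm r₂ a] at this
        omega
      have h1 : (r₂ - b₀) * (r₂ * β) ≤ (r₂ - b₀) * (r₁ * (d + 1)) := Nat.mul_le_mul_left _ hle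
      have e1 : (r₂ - b₀) * (r₁ * (d + 1)) + b₀ * (r₁ * (d + 1)) = r₂ * (r₁ * (d + 1)) := by
        rw [← Nat.add_mul, Nat.sub_add_cancel hb₀r]
      have e2 : (r₂ - b₀) * (r₂ * β) = r₂ * (β * (r₂ - b₀)) := by ring
      have e6 : r₂ * (r₁ * (d + 1)) = r₂ * ((r₁ - a) * (d + 1)) + r₂ * (a * (d + 1)) := by
        rw [← Nat.mul_add, ← Nat.add_mul, Nat.sub_add_cancel har.le]
      have h2 : r₂ * (β * (r₂ - b₀)) < r₂ * ((r₁ - a) * (d + 1)) := by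
        rw [← e2]
        omega
      have h3 := Nat.lt_of_mul_lt_mul_left h2
      have e7 : β * r₂ = β * (r₂ - b₀) + β * b₀ := by rw [← Nat.mul_add, Nat.sub_add_cancel hb₀r]
      have e8 : r₁ * (d + 1) = (r₁ - a) * (d + 1) + a * (d + 1) := by rw [← Nat.add_mul, Nat.sub_add_cancel har.le]
      have e9 : r₂ * β = β * r₂ := mul_comm _ _
      omega
  · have : α = ν := le_antisymm h h'
    subst this
    have hβ : 1 ≤ β := by omega
    have h1 : b₀ ≤ β * b₀ := Nat.le_mul_of_pos_left b₀ hβ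
    omega

/-! ## §1 `REST' ≤ F(νa+1)` with `g₂' ∈ F(b₀)` -/

section LocalRing

variable {S : Type u} [CommRing S] [IsLocalRing S]

/-- `REST' ≤ F(νa+1)` when `g₁' ∈ F(a)`, `g₂' ∈ F(b₀)`, `1 ≤ a`, `1 ≤ b₀ ≤ r₂`, `a·r₂ < b₀·r₁`. [folklore] -/
theorem rest₂_le_flagContactFiltration' {g₁ g₂ g₁' g₂' : S} {q r₁ r₂ a b₀ : ℕ} (hq : 0 < q) (ha : 1 ≤ a) (hb₀ : 1 ≤ b₀)
    (hb₀r : b₀ ≤ r₂) (hab : a * r₂ < b₀ * r₁) (h₁ : g₁' ∈ flagContactFiltration g₁ g₂ q r₁ r₂ a)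
    (h₂ : g₂' ∈ flagContactFiltration g₁ g₂ q r₁ r₂ b₀) (ν : ℕ) :
    (⨆ α : ℕ, ⨆ β : ℕ, ⨆ (_ : ¬ (α = ν ∧ β = 0)),
        Ideal.span {g₁' ^ α * g₂' ^ β} * maximalIdeal S ^ ((r₁ * ν - r₁ * α - r₂ * β + q - 1) / q)) ≤
      flagContactFiltration g₁ g₂ q r₁ r₂ (ν * a + 1) := by
  refine iSup_le fun α => iSup_le fun β => iSup_le fun hne => ?_
  set e := (r₁ * ν - r₁ * α - r₂ * β + q - 1) / q with he
  have hE : ν * a + 1 ≤ α * a + β * b₀ + q * e :=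
    succ_le_weight_of_ne_top_piece' ha hb₀ hb₀r hab hne (by simpa [he] using le_add_mul_cdiv hq (r₁ * ν - r₁ * α - r₂ * β) 0)
  have hA : Ideal.span {g₁' ^ α * g₂' ^ β} ≤ flagContactFiltration g₁ g₂ q r₁ r₂ (a * α + b₀ * β) := by
    rw [Ideal.span_singleton_le_iff_mem]
    have hα : g₁' ^ α ∈ flagContactFiltration g₁ g₂ q r₁ r₂ (a * α) :=
      pow_le_flagContactFiltration_mul g₁ g₂ r₁ r₂ hq a α (Ideal.pow_mem_pow h₁ α)
    have hβ : g₂' ^ β ∈ flagContactFiltration g₁ g₂ q r₁ r₂ (b₀ * β) :=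
      pow_le_flagContactFiltration_mul g₁ g₂ r₁ r₂ hq b₀ β (Ideal.pow_mem_pow h₂ β)
    exact flagContactFiltration_mul_le g₁ g₂ q r₁ r₂ hq _ _ (Ideal.mul_mem_mul hα hβ)
  have hB : maximalIdeal S ^ e ≤ flagContactFiltration g₁ g₂ q r₁ r₂ (q * e) :=
    (Ideal.pow_right_mono (maximalIdeal_le_flagContactFiltration g₁ g₂ r₁ r₂ hq) e).trans
      (pow_le_flagContactFiltration_mul g₁ g₂ r₁ r₂ hq q e)
  refine (Ideal.mul_mono hA hB).trans ((flagContactFiltration_mul_le g₁ g₂ q r₁ r₂ hq _ _).trans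
    (flagContactFiltration_antitone g₁ g₂ q r₁ r₂ ?_))
  have : a * α + b₀ * β = α * a + β * b₀ := by ring
  omega

end LocalRing

/-! ## §2 (E1″) -/

section Regular

variable {S : Type} [CommRing S] [IsRegularLocalRing S]

/-- **(E1″) The θ-bound on the first member.**  In a regular local ring of dimension `3` with `𝔪 = (x, g₂, g₁)`: if `f ∉ 𝔪^{ν+1}` (`0 < ν`)
lies in level `r₁ν` of the `(q; r₁, r₂)`-filtrations of `(g₁, g₂)` and of `g₁', g₂' ∈ 𝔪`, `0 < q ≤ r₂ < r₁`, and `g₂' ∈ F(b₀)` with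
`1 ≤ b₀ ≤ r₂`, then `g₁' ∈ F(k+1)` for every `k` with `k + 1 ≤ r₁` and `k·r₂ < b₀·r₁`.  No maximality is used. [OURS · L1 W4.3 · (o70-b)] -/
theorem mem_succ_of_mem_weight₂_le (hdim : ringKrullDim S = 3) {x g₁ g₂ g₁' g₂' f : S} {q r₁ r₂ ν b₀ k : ℕ}
    (h𝔪 : Ideal.span {x, g₂, g₁} = maximalIdeal S) (hq : 0 < q) (hq₂ : q ≤ r₂) (hr : r₂ < r₁) (hν : 0 < ν)
    (hf : f ∉ maximalIdeal S ^ (ν + 1)) (hF : f ∈ flagContactFiltration g₁ g₂ q r₁ r₂ (r₁ * ν))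
    (hg₁' : g₁' ∈ maximalIdeal S) (hg₂' : g₂' ∈ maximalIdeal S) (hF' : f ∈ flagContactFiltration g₁' g₂' q r₁ r₂ (r₁ * ν))
    (hb₀ : 1 ≤ b₀) (hb₀r : b₀ ≤ r₂) (h₂ : g₂' ∈ flagContactFiltration g₁ g₂ q r₁ r₂ b₀) (hk : k + 1 ≤ r₁)
    (hkb : k * r₂ < b₀ * r₁) : g₁' ∈ flagContactFiltration g₁ g₂ q r₁ r₂ (k + 1) := by
  classical
  -- below `q` there is nothing to prove
  rcases Nat.lt_or_ge k q with hkq | hqk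
  · exact flagContactFiltration_antitone g₁ g₂ q r₁ r₂ (Nat.succ_le_of_lt hkq)
      (maximalIdeal_le_flagContactFiltration g₁ g₂ r₁ r₂ hq hg₁')
  by_contra h₁
  set P : ℕ → Prop := fun n => g₁' ∈ flagContactFiltration g₁ g₂ q r₁ r₂ n with hP
  set a := Nat.findGreatest P (k + 1) with ha
  have hq₁ : q ≤ r₁ := hq₂.trans hr.le
  have hPq : P q := maximalIdeal_le_flagContactFiltration g₁ g₂ r₁ r₂ hq hg₁'
  have hqk1 : q ≤ k + 1 := hqk.trans (Nat.le_succ k)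
  have hPa : g₁' ∈ flagContactFiltration g₁ g₂ q r₁ r₂ a := Nat.findGreatest_spec (P := P) hqk1 hPq
  have hqa : q ≤ a := Nat.le_findGreatest hqk1 hPq
  have hak1 : a ≤ k + 1 := Nat.findGreatest_le (k + 1)
  have hane : a ≠ k + 1 := fun h => h₁ (by rw [h] at hPa; exact hPa)
  have hak : a ≤ k := by omega
  have hnot : g₁' ∉ flagContactFiltration g₁ g₂ q r₁ r₂ (a + 1) :=
    Nat.findGreatest_is_greatest (P := P) (Nat.lt_succ_self a) (by omega)
  have ha1 : 1 ≤ a := hq.trans_le hqa |> Nat.succ_le_of_lt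
  have har : a + 1 ≤ r₁ := by omega
  have hab : a * r₂ < b₀ * r₁ := lt_of_le_of_lt (Nat.mul_le_mul_right r₂ hak) hkb
  -- `f = c · g₁'^ν + m'`, `c` a unit, `m' ∈ F(νa+1)`
  obtain ⟨t, ht, m', hm', hsum⟩ := Submodule.mem_sup.mp (flagContactFiltration_le_span_pow_sup_rest₂ g₁' g₂' q r₁ r₂ ν hF')
  obtain ⟨c, rfl⟩ := Ideal.mem_span_singleton'.mp ht
  have hc : IsUnit c := by
    by_contra hcu
    refine hf ?_
    rw [← hsum]
    refine Ideal.add_mem _ ?_ (rest₂_le_pow_succ hg₁' hg₂' hq hq₂ hr ν hm')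
    rw [pow_succ']
    exact Ideal.mul_mem_mul ((IsLocalRing.mem_maximalIdeal c).mpr hcu) (Ideal.pow_mem_pow hg₁' ν)
  have hm'F : m' ∈ flagContactFiltration g₁ g₂ q r₁ r₂ (ν * a + 1) :=
    rest₂_le_flagContactFiltration' hq ha1 hb₀ hb₀r hab hPa h₂ ν hm'
  have hfF : f ∈ flagContactFiltration g₁ g₂ q r₁ r₂ (ν * a + 1) := by
    refine flagContactFiltration_antitone g₁ g₂ q r₁ r₂ ?_ hF
    have := Nat.mul_le_mul_left ν har
    rw [Nat.mul_add, mul_one] at this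
    have hν' : ν * a + 1 ≤ ν * a + ν := by omega
    rw [mul_comm r₁]
    exact hν'.trans this
  have hcg : c * g₁' ^ ν ∈ flagContactFiltration g₁ g₂ q r₁ r₂ (ν * a + 1) := by
    have : c * g₁' ^ ν = f - m' := by rw [← hsum]; ring
    rw [this]
    exact Ideal.sub_mem _ hfF hm'F
  -- the valuation property of the weighted order of `(x, g₂, g₁; q, r₂, r₁)`
  have hw : ∀ i, 0 < (![q, r₂, r₁] : Fin 3 → ℕ) i := by
    intro i
    fin_cases i
    · exact hq
    · exact lt_of_lt_of_le hq hq₂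
    · exact lt_of_lt_of_le hq hq₁
  have hgen : Ideal.span {(![x, g₂, g₁] : Fin 3 → S) 0, (![x, g₂, g₁] : Fin 3 → S) 1, (![x, g₂, g₁] : Fin 3 → S) 2} =
      maximalIdeal S := by
    simpa using h𝔪
  have hbridge : ∀ n, flagContactFiltration g₁ g₂ q r₁ r₂ n = weightedIdealW ![x, g₂, g₁] ![q, r₂, r₁] n := fun n => by
    rw [flagContactFiltration_eq_weightedMonomialIdeal h𝔪 hq hq₂ hq₁ n, CrossingPoint.weightedMonomialIdeal_eq_weightedIdealW]
  have hga : g₁' ∈ weightedIdealW ![x, g₂, g₁] ![q, r₂, r₁] a := by rw [← hbridge]; exact hPa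
  have hga' : g₁' ∉ weightedIdealW ![x, g₂, g₁] ![q, r₂, r₁] (a + 1) := by rw [← hbridge]; exact hnot
  have := mul_pow_not_mem_weightedIdealW ![x, g₂, g₁] hgen hdim hw hga hga' hc hν
  rw [← hbridge] at this
  exact this hcg

/-- **(E1″) with the completing parameter supplied** ((o70-x), regular local of dimension `3`): for a two-flag `(g₁, g₂)` and a second
pair reaching the same triple, `g₂' ∈ F(b₀)` (`1 ≤ b₀ ≤ r₂`), `k + 1 ≤ r₁`, `k·r₂ < b₀·r₁` ⇒ `g₁' ∈ F(k+1)`. [OURS · L1 W4.3 · (o70-b)] -/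
theorem IsTwoFlag.mem_succ_of_mem_weight₂_le (hdim : ringKrullDim S = (3 : ℕ)) {g₁ g₂ g₁' g₂' f : S} {q r₁ r₂ ν b₀ k : ℕ}
    (hΦ : IsTwoFlag g₁ g₂) (hq : 0 < q) (hq₂ : q ≤ r₂) (hr : r₂ < r₁) (hν : 0 < ν) (hf : f ∉ maximalIdeal S ^ (ν + 1))
    (hF : f ∈ flagContactFiltration g₁ g₂ q r₁ r₂ (r₁ * ν)) (hg₁' : g₁' ∈ maximalIdeal S) (hg₂' : g₂' ∈ maximalIdeal S)
    (hF' : f ∈ flagContactFiltration g₁' g₂' q r₁ r₂ (r₁ * ν)) (hb₀ : 1 ≤ b₀) (hb₀r : b₀ ≤ r₂)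
    (h₂ : g₂' ∈ flagContactFiltration g₁ g₂ q r₁ r₂ b₀) (hk : k + 1 ≤ r₁) (hkb : k * r₂ < b₀ * r₁) :
    g₁' ∈ flagContactFiltration g₁ g₂ q r₁ r₂ (k + 1) := by
  obtain ⟨x, hx, -⟩ := exists_span_triple_of_isTwoFlag S hdim g₁ g₂ hΦ
  have hdim' : ringKrullDim S = 3 := by rw [hdim]; rfl
  exact _root_.Summit.ResolutionOfSingularities.ResolutionOfSingularities.Cruxes.HypersurfaceCentreConstruction.LocalEngine.Iota3.mem_succ_of_mem_weight₂_le
    hdim' hx hq hq₂ hr hν hf hF hg₁' hg₂' hF' hb₀ hb₀r h₂ hk hkb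

end Regular

end Iota3

end Summit.ResolutionOfSingularities.ResolutionOfSingularities.Cruxes.HypersurfaceCentreConstruction.LocalEngine

end
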